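import Summits.Parity.BatemanHorn.Theorems.SoloInformedSystemPrimeCount
import Summits.Parity.BatemanHorn.Theorems.SoloInformedLambdaKValues
import Summits.Parity.BatemanHorn.Theorems.SoloInformedProperPrimePowerCount
import Summits.Parity.BatemanHorn.Theorems.SoloInformedSmoothValues
import Literature.NumberTheory.Sieve.BatemanHornLocalCounts

/-!
# SoloInformedSystemPsiK — the `ψ_k`-form of the Bateman–Horn conjecture for EVERY system

Solo unit `solo-Parity-informed` (informed mode), session 16; `PLAN.md` §24, CLAIMS C73.
For any Bateman–Horn system `f : ι → ℤ[X]` (`k = card ι ≥ 1`, `F = ∏ᵢ fᵢ`, `Λ_k = μ ⋆ log^k`):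
`BatemanHornAsymptotic f ⟺ ∑_{1 ≤ n ≤ x} Λ_k(|F(n)|) ~ k! · C(f) · x`
(`batemanHornAsymptotic_iff_isEquivalent_psiK`): the conjunct is, system by system, a statement about ONE
one-dimensional divisor sum along the values of ONE integer polynomial — the analogue of `ψ(x) ~ x`.
Proof: `ψ_{k,f}(x) - k! Θ_f(x) = o(x)` (`isLittleO_psiK_sub_theta`; `Θ_f` = the form of
`SoloInformedSystemPrimeCount`).  For `n` large, primes `> P` divide at most one `fᵢ(n)` and all
`|fᵢ(n)| > P + 1`; so all-prime values are distinct (`Λ_k = k! ∏ log`, `SoloInformedLambdaKValues`), and a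
degenerate `n` with `Λ_k(|F(n)|) ≠ 0` has a proper-prime-power value or a `P`-smooth value
(`primePow_or_smooth_of_card_primeFactors_le`) — both sets are `o(x / log^k x)`
(`SoloInformedProperPrimePowerCount`, `SoloInformedSmoothValues`), the weights `≪ log^k x`.
-/

namespace Summit.Parity.BatemanHorn.Theorems

open Finset Filter ArithmeticFunction Asymptotics Polynomial
open scoped Topology
open Literature.NumberTheory.Sieve (IsBatemanHornSystem batemanHornConst BatemanHornAsymptotic
  generalizedVonMangoldt generalizedVonMangoldt_le generalizedVonMangoldt_nonneg
  generalizedVonMangoldt_eq_zero_of_lt_card_primeFactors exists_forall_not_dvd_eval_and_dvd_eval)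

variable {ι : Type*} [Fintype ι]

omit [Fintype ι] in
/-- If primes `> P` divide at most one of the `m i`, all `m i > P`, and all `m i` are prime, then the `m i`
are pairwise distinct. -/
theorem injective_of_forall_prime {m : ι → ℕ} {P : ℕ} (hmP : ∀ i, P < m i)
    (hsep : ∀ q : ℕ, q.Prime → P < q → ∀ i j, i ≠ j → ¬ (q ∣ m i ∧ q ∣ m j))
    (hprime : ∀ i, (m i).Prime) : Function.Injective m := by
  intro i j h
  by_contra hij
  exact hsep (m i) (hprime i) (hmP i) i j hij ⟨dvd_rfl, ⟨1, by rw [h, mul_one]⟩⟩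

/-- **The alternative.**  If primes `> P` divide at most one of the non-zero `m i` (`i ∈ ι`) and `∏ m i`
has at most `card ι` prime factors, then either every `m i` is a prime power, or some `m l` has all its prime
factors `≤ P`. -/
theorem primePow_or_smooth_of_card_primeFactors_le {m : ι → ℕ} (hm : ∀ i, m i ≠ 0) {P : ℕ}
    (hsep : ∀ q : ℕ, q.Prime → P < q → ∀ i j, i ≠ j → ¬ (q ∣ m i ∧ q ∣ m j))
    (hω : (∏ i, m i).primeFactors.card ≤ Fintype.card ι) :
    (∀ i, ∃ q a : ℕ, q.Prime ∧ m i = q ^ a) ∨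
      (∃ l, ∀ q ∈ (m l).primeFactors, q ≤ P) := by
  classical
  by_cases hsm : ∃ l, ∀ q ∈ (m l).primeFactors, q ≤ P
  · exact Or.inr hsm
  left
  push Not at hsm
  choose q hqmem hqP using hsm
  have hqprime : ∀ l, (q l).Prime := fun l => Nat.prime_of_mem_primeFactors (hqmem l)
  have hqdvd : ∀ l, q l ∣ m l := fun l => Nat.dvd_of_mem_primeFactors (hqmem l)
  have hinj : Function.Injective q := by
    intro i j h
    by_contra hij
    exact hsep (q i) (hqprime i) (hqP i) i j hij ⟨hqdvd i, h ▸ hqdvd j⟩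
  have hne : ∏ i, m i ≠ 0 := prod_ne_zero_iff.mpr fun i _ => hm i
  have hdvdprod : ∀ i, m i ∣ ∏ j, m j := fun i => dvd_prod_of_mem m (mem_univ i)
  have himg : univ.image q ⊆ (∏ i, m i).primeFactors := by
    intro p hp
    obtain ⟨l, -, rfl⟩ := mem_image.mp hp
    exact Nat.mem_primeFactors.mpr ⟨hqprime l, (hqdvd l).trans (hdvdprod l), hne⟩
  have heq : univ.image q = (∏ i, m i).primeFactors := by
    refine eq_of_subset_of_card_le himg ?_
    rw [card_image_of_injective _ hinj, card_univ]
    exact hω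
  intro i
  refine ⟨q i, _, hqprime i, Nat.eq_prime_pow_of_unique_prime_dvd (hm i) ?_⟩
  intro p hp hpd
  have hpmem : p ∈ (∏ i, m i).primeFactors :=
    Nat.mem_primeFactors.mpr ⟨hp, hpd.trans (hdvdprod i), hne⟩
  rw [← heq] at hpmem
  obtain ⟨j, -, hj⟩ := mem_image.mp hpmem
  by_contra hne'
  have hij : i ≠ j := by rintro rfl; exact hne' hj.symm
  exact hsep (q j) (hqprime j) (hqP j) i j hij ⟨hj ▸ hpd, hqdvd j⟩

/-- For a Bateman–Horn system: a bound `P` beyond which no prime divides two of the values `fᵢ(n)`, `fⱼ(n)`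
(`i ≠ j`), and a threshold `N` beyond which every `|fᵢ(n)| > P + 1`. -/
theorem exists_sep_and_large {f : ι → ℤ[X]} (hf : IsBatemanHornSystem f) :
    ∃ P N : ℕ, (∀ q : ℕ, q.Prime → P < q → ∀ i j, i ≠ j → ∀ n : ℕ,
        ¬ (q ∣ ((f i).eval (n : ℤ)).natAbs ∧ q ∣ ((f j).eval (n : ℤ)).natAbs)) ∧
      ∀ n : ℕ, N ≤ n → ∀ i, P + 1 < ((f i).eval (n : ℤ)).natAbs := by
  obtain ⟨P, hP⟩ := exists_forall_not_dvd_eval_and_dvd_eval hf.irreducible hf.pairwise_not_associated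
  have hev : ∀ i, ∀ᶠ n : ℕ in atTop, P + 1 < ((f i).eval (n : ℤ)).natAbs := by
    intro i
    obtain ⟨B, hB⟩ := exists_abs_log_natAbs_eval_sub_le (hf.natDegree_pos i)
    have hlog : Tendsto (fun n : ℕ => Real.log n) atTop atTop :=
      Real.tendsto_log_atTop.comp tendsto_natCast_atTop_atTop
    filter_upwards [hlog.eventually (eventually_gt_atTop (B + Real.log ((P : ℝ) + 2))),
      eventually_ge_atTop 1] with n hn hn1
    by_contra hle
    push Not at hle
    have h1 := (abs_le.mp (hB n hn1)).1
    have hd1 : (1 : ℝ) ≤ (f i).natDegree := by exact_mod_cast hf.natDegree_pos i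
    have hlogn : 0 ≤ Real.log n := Real.log_nonneg (by exact_mod_cast hn1)
    have h2 : Real.log n ≤ (f i).natDegree * Real.log n := le_mul_of_one_le_left hlogn hd1
    have hP2 : (0 : ℝ) < (P : ℝ) + 2 := by positivity
    have h3 : Real.log ((((f i).eval (n : ℤ)).natAbs : ℕ) : ℝ) ≤ Real.log ((P : ℝ) + 2) := by
      rcases Nat.eq_zero_or_pos ((f i).eval (n : ℤ)).natAbs with h0 | hpos
      · rw [h0, Nat.cast_zero, Real.log_zero]
        exact Real.log_nonneg (by linarith)
      · exact Real.log_le_log (by exact_mod_cast hpos) (by exact_mod_cast (by omega :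
          ((f i).eval (n : ℤ)).natAbs ≤ P + 2))
    linarith
  obtain ⟨N, hN⟩ := eventually_atTop.mp (Filter.eventually_all.mpr hev)
  refine ⟨P, N, fun q _ hPq i j hij n => ?_, fun n hn i => hN n hn i⟩
  have h := hP q hPq i j hij (n : ℤ)
  rwa [Int.natCast_dvd, Int.natCast_dvd] at h

/-- Asymptotic equivalence is preserved by multiplication with a constant (also `c = 0`). -/
theorem isEquivalent_const_mul_left {α : Type*} {l : Filter α} {u v : α → ℝ} (h : u ~[l] v) (c : ℝ) :
    (fun x => c * u x) ~[l] fun x => c * v x := by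
  rcases eq_or_ne c 0 with rfl | hc
  · simp only [zero_mul]
    exact IsEquivalent.refl
  rw [IsEquivalent] at h ⊢
  have e : ((fun x => c * u x) - fun x => c * v x) = fun x => c * (u - v) x := by
    funext x
    simp only [Pi.sub_apply, mul_sub]
  rw [e, isLittleO_const_mul_left_iff hc, isLittleO_const_mul_right_iff hc]
  exact h

/-- If `u - w = o(v)` then `u ~ v ↔ w ~ v`. -/
theorem isEquivalent_congr_of_isLittleO_sub {α : Type*} {l : Filter α} {u w v : α → ℝ}
    (h : (fun x => u x - w x) =o[l] v) : u ~[l] v ↔ w ~[l] v := by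
  constructor
  · intro hu
    exact (hu.add_isLittleO h.neg_left).congr_left (Eventually.of_forall fun x => by simp)
  · intro hw
    exact (hw.add_isLittleO h).congr_left (Eventually.of_forall fun x => by simp)

open scoped Classical in
/-- **The degenerate arguments are negligible:** for a Bateman–Horn system `f` with `k = card ι ≥ 1`,
`∑_{n ≤ x} Λ_k(|∏ fᵢ(n)|) - k! ∑_{n ≤ x, all |fᵢ(n)| prime} ∏ log |fᵢ(n)| = o(x)`. -/
theorem isLittleO_psiK_sub_theta {f : ι → ℤ[X]} (hf : IsBatemanHornSystem f)
    (hk : 0 < Fintype.card ι) :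
    (fun x : ℕ => ∑ n ∈ Icc 1 x, generalizedVonMangoldt (Fintype.card ι) ((∏ i, f i).eval (n : ℤ)).natAbs
        - ((Fintype.card ι).factorial : ℝ) *
          ∑ n ∈ (Icc 1 x).filter (fun n : ℕ => ∀ i, Nat.Prime ((f i).eval (n : ℤ)).natAbs),
            ∏ i, Real.log ((((f i).eval (n : ℤ)).natAbs : ℕ) : ℝ))
      =o[atTop] fun x : ℕ => (x : ℝ) := by
  set k := Fintype.card ι with hkdef
  obtain ⟨P, N, hsep, hlarge⟩ := exists_sep_and_large hf
  set m : ι → ℕ → ℕ := fun i n => ((f i).eval (n : ℤ)).natAbs with hm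
  set Λk : ℕ → ℝ := fun n => generalizedVonMangoldt k ((∏ i, f i).eval (n : ℤ)).natAbs with hΛk
  set θ : ℕ → ℝ := fun n => ∏ i, Real.log ((m i n : ℕ) : ℝ) with hθ
  set g : ℕ → ℝ := fun n => Λk n - if (∀ i, (m i n).Prime) then (k.factorial : ℝ) * θ n else 0 with hg
  have hlarge' : ∀ n, N ≤ n → ∀ i, P + 1 < m i n := fun n hn i => hlarge n hn i
  have hsep' : ∀ n : ℕ, ∀ q : ℕ, q.Prime → P < q → ∀ i j, i ≠ j → ¬ (q ∣ m i n ∧ q ∣ m j n) :=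
    fun n q hq hPq i j hij => hsep q hq hPq i j hij n
  have hprod : ∀ n : ℕ, ((∏ i, f i).eval (n : ℤ)).natAbs = ∏ i, m i n := by
    intro n
    rw [eval_prod]
    exact map_prod Int.natAbsHom _ _
  have hΛk' : ∀ n, Λk n = generalizedVonMangoldt k (∏ i, m i n) := by
    intro n
    simp only [hΛk, hprod n]
  have hkey : ∀ n, N ≤ n → (∀ i, (m i n).Prime) → Λk n = (k.factorial : ℝ) * θ n := by
    intro n hn hpr
    have hinj : Function.Injective fun i => m i n :=
      injective_of_forall_prime (m := fun i => m i n) (fun i => by have := hlarge' n hn i; omega)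
        (hsep' n) hpr
    exact generalizedVonMangoldt_prod_eval_natAbs f hpr hinj
  have hdeg : ∀ n, N ≤ n → ¬ (∀ i, (m i n).Prime) → Λk n ≠ 0 →
      (∃ i, ∃ p a : ℕ, p.Prime ∧ 2 ≤ a ∧ m i n = p ^ a) ∨
        (∃ l, m l n ≠ 0 ∧ ∀ q ∈ (m l n).primeFactors, q ≤ P) := by
    intro n hn hnot hΛ
    have hm0 : ∀ i, m i n ≠ 0 := fun i => by have := hlarge' n hn i; omega
    have hω : (∏ i, m i n).primeFactors.card ≤ k := by
      by_contra h
      push Not at h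
      exact hΛ (by rw [hΛk' n]; exact generalizedVonMangoldt_eq_zero_of_lt_card_primeFactors h)
    rcases primePow_or_smooth_of_card_primeFactors_le (m := fun i => m i n) hm0 (hsep' n) hω
      with hpp | ⟨l, hl⟩
    · left
      push Not at hnot
      obtain ⟨i, hi⟩ := hnot
      obtain ⟨p, a, hp, hpe⟩ := hpp i
      refine ⟨i, p, a, hp, ?_, hpe⟩
      have h2 : 2 ≤ m i n := by have := hlarge' n hn i; omega
      by_contra hlt
      push Not at hlt
      have h01 : a = 0 ∨ a = 1 := by omega
      rcases h01 with h0 | h1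
      · rw [h0, pow_zero] at hpe
        omega
      · rw [h1, pow_one] at hpe
        exact hi (hpe ▸ hp)
    · exact Or.inr ⟨l, hm0 l, hl⟩
  choose B hB using fun i => exists_abs_log_natAbs_eval_sub_le (hf.natDegree_pos i)
  set D : ℝ := ∑ i, ((f i).natDegree : ℝ) with hD
  set Bt : ℝ := ∑ i, |B i| with hBt
  have hBt0 : 0 ≤ Bt := sum_nonneg fun i _ => abs_nonneg _
  have hD0 : 0 ≤ D := sum_nonneg fun i _ => Nat.cast_nonneg _
  set c : ℝ := (D + Bt) ^ k with hc
  have hc0 : 0 ≤ c := by positivity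
  have hΛk_le : ∀ x n : ℕ, 1 ≤ Real.log x → n ∈ Icc 1 x → Λk n ≤ c * Real.log x ^ k := by
    intro x n hLx hn
    obtain ⟨hn1, hnx⟩ := mem_Icc.mp hn
    have hlogn : Real.log n ≤ Real.log x :=
      Real.log_le_log (by exact_mod_cast hn1) (by exact_mod_cast hnx)
    have hlogn0 : 0 ≤ Real.log n := Real.log_nonneg (by exact_mod_cast hn1)
    have hsum : Real.log (((∏ i, m i n : ℕ) : ℝ)) ≤ ∑ i, Real.log ((m i n : ℕ) : ℝ) := by
      by_cases h0 : ∃ i, m i n = 0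
      · obtain ⟨i, hi⟩ := h0
        rw [prod_eq_zero (mem_univ i) hi, Nat.cast_zero, Real.log_zero]
        exact sum_nonneg fun j _ => Real.log_natCast_nonneg _
      · push Not at h0
        rw [Nat.cast_prod, Real.log_prod]
        exact fun j _ => Nat.cast_ne_zero.mpr (h0 j)
    have heach : ∀ i, Real.log ((m i n : ℕ) : ℝ) ≤ (f i).natDegree * Real.log n + |B i| := by
      intro i
      have := (abs_le.mp (hB i n hn1)).2
      linarith [le_abs_self (B i)]
    have h1 : Real.log (((∏ i, m i n : ℕ) : ℝ)) ≤ (D + Bt) * Real.log x :=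
      calc Real.log (((∏ i, m i n : ℕ) : ℝ)) ≤ ∑ i, Real.log ((m i n : ℕ) : ℝ) := hsum
        _ ≤ ∑ i, (((f i).natDegree : ℝ) * Real.log n + |B i|) := sum_le_sum fun i _ => heach i
        _ = D * Real.log n + Bt := by rw [sum_add_distrib, hD, hBt, sum_mul]
        _ ≤ D * Real.log x + Bt * Real.log x :=
            add_le_add (mul_le_mul_of_nonneg_left hlogn hD0) (le_mul_of_one_le_right hBt0 hLx)
        _ = (D + Bt) * Real.log x := by ring
    have h0 : 0 ≤ Real.log (((∏ i, m i n : ℕ) : ℝ)) := Real.log_natCast_nonneg _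
    calc Λk n = generalizedVonMangoldt k (∏ i, m i n) := hΛk' n
      _ ≤ Real.log (((∏ i, m i n : ℕ) : ℝ)) ^ k := generalizedVonMangoldt_le hk _
      _ ≤ ((D + Bt) * Real.log x) ^ k := pow_le_pow_left₀ h0 h1 k
      _ = c * Real.log x ^ k := by rw [hc, mul_pow]
  have hident : ∀ x : ℕ, ∑ n ∈ Icc 1 x, Λk n - (k.factorial : ℝ) *
      ∑ n ∈ (Icc 1 x).filter (fun n : ℕ => ∀ i, (m i n).Prime), θ n = ∑ n ∈ Icc 1 x, g n := by
    intro x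
    simp only [hg, sum_sub_distrib, sum_filter, mul_sum, mul_ite, mul_zero]
  set C₁ : ℝ := ∑ n ∈ range N, |g n| with hC₁
  rw [isLittleO_iff]
  intro δ hδ
  have hkR : (0 : ℝ) < k := by exact_mod_cast hk
  set δ' : ℝ := δ / 2 / ((c + 1) * (2 * k)) with hδ'
  have hδ'0 : 0 < δ' := by positivity
  have hPP : ∀ i, ∀ᶠ x : ℕ in atTop, (#((Icc 1 x).filter fun n : ℕ =>
      ∃ p a : ℕ, p.Prime ∧ 2 ≤ a ∧ m i n = p ^ a) : ℝ) * Real.log x ^ k ≤ δ' * x :=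
    fun i => eventually_card_properPrimePow_mul_log_pow_le (hf.irreducible i) (hf.natDegree_pos i)
      (hf.leadingCoeff_pos i) k hδ'0
  have hSM : ∀ i, ∀ᶠ x : ℕ in atTop, (#((Icc 1 x).filter fun n : ℕ =>
      m i n ≠ 0 ∧ ∀ q ∈ (m i n).primeFactors, q ≤ P) : ℝ) * Real.log x ^ k ≤ δ' * x :=
    fun i => eventually_card_smoothValues_mul_log_pow_le (hf.natDegree_pos i) P k hδ'0
  have hC₁x : ∀ᶠ x : ℕ in atTop, C₁ ≤ δ / 2 * x := by
    filter_upwards [(tendsto_natCast_atTop_atTop (R := ℝ)).eventually_ge_atTop (C₁ / (δ / 2))]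
      with x hx
    rw [div_le_iff₀ (by positivity)] at hx
    linarith
  have hlog1 : ∀ᶠ x : ℕ in atTop, 1 ≤ Real.log x :=
    (Real.tendsto_log_atTop.comp tendsto_natCast_atTop_atTop).eventually_ge_atTop 1
  filter_upwards [Filter.eventually_all.mpr hPP, Filter.eventually_all.mpr hSM, hC₁x, hlog1]
    with x hPPx hSMx hC₁x' hLx
  have hfun : (∑ n ∈ Icc 1 x, generalizedVonMangoldt (Fintype.card ι) ((∏ i, f i).eval (n : ℤ)).natAbs
        - ((Fintype.card ι).factorial : ℝ) *
          ∑ n ∈ (Icc 1 x).filter (fun n : ℕ => ∀ i, Nat.Prime ((f i).eval (n : ℤ)).natAbs),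
            ∏ i, Real.log ((((f i).eval (n : ℤ)).natAbs : ℕ) : ℝ)) = ∑ n ∈ Icc 1 x, g n := hident x
  rw [hfun, Real.norm_eq_abs, Real.norm_eq_abs, Nat.abs_cast]
  set S := Icc 1 x with hS
  set T := S.filter (fun n : ℕ => ¬ n < N) with hT
  set Bad := (univ : Finset ι).biUnion (fun i => S.filter fun n : ℕ =>
      ∃ p a : ℕ, p.Prime ∧ 2 ≤ a ∧ m i n = p ^ a)
    ∪ (univ : Finset ι).biUnion (fun i => S.filter fun n : ℕ =>
      m i n ≠ 0 ∧ ∀ q ∈ (m i n).primeFactors, q ≤ P) with hBad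
  have hlow : ∑ n ∈ S.filter (fun n : ℕ => n < N), |g n| ≤ C₁ := by
    apply sum_le_sum_of_subset_of_nonneg
    · intro n hn
      exact mem_range.mpr (mem_filter.mp hn).2
    · exact fun n _ _ => abs_nonneg _
  have hT_pt : ∀ n ∈ T.filter (fun n => |g n| ≠ 0), |g n| ≤ c * Real.log x ^ k ∧ n ∈ Bad := by
    intro n hn
    obtain ⟨hnT, hgn⟩ := mem_filter.mp hn
    obtain ⟨hnS, hnN⟩ := mem_filter.mp hnT
    have hNn : N ≤ n := not_lt.mp hnN
    have hnot : ¬ ∀ i, (m i n).Prime := by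
      intro hall
      apply hgn
      simp only [hg, if_pos hall, hkey n hNn hall, sub_self, abs_zero]
    have hgn' : g n = Λk n := by simp only [hg, if_neg hnot, sub_zero]
    have hΛ0 : Λk n ≠ 0 := by
      intro h
      apply hgn
      rw [hgn', h, abs_zero]
    refine ⟨?_, ?_⟩
    · rw [hgn', abs_of_nonneg (by rw [hΛk' n]; exact generalizedVonMangoldt_nonneg _ _)]
      exact hΛk_le x n hLx hnS
    · rcases hdeg n hNn hnot hΛ0 with ⟨i, p, a, hp, ha, he⟩ | ⟨l, hl0, hl⟩
      · exact mem_union_left _ (mem_biUnion.mpr ⟨i, mem_univ i, mem_filter.mpr ⟨hnS, p, a, hp, ha, he⟩⟩)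
      · exact mem_union_right _ (mem_biUnion.mpr ⟨l, mem_univ l, mem_filter.mpr ⟨hnS, hl0, hl⟩⟩)
  have hckx : 0 ≤ c * Real.log x ^ k := mul_nonneg hc0 (pow_nonneg (by linarith) k)
  have hhigh : ∑ n ∈ T, |g n| ≤ #Bad * (c * Real.log x ^ k) := by
    rw [← sum_filter_ne_zero T]
    calc ∑ n ∈ T.filter (fun n => |g n| ≠ 0), |g n|
        ≤ #(T.filter fun n => |g n| ≠ 0) • (c * Real.log x ^ k) :=
          sum_le_card_nsmul _ _ _ fun n hn => (hT_pt n hn).1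
      _ ≤ #Bad • (c * Real.log x ^ k) :=
          nsmul_le_nsmul_left hckx (card_le_card fun n hn => (hT_pt n hn).2)
      _ = #Bad * (c * Real.log x ^ k) := nsmul_eq_mul _ _
  have hBadle : (#Bad : ℝ) ≤ (∑ i, (#(S.filter fun n : ℕ => ∃ p a : ℕ, p.Prime ∧ 2 ≤ a ∧ m i n = p ^ a) : ℝ))
      + ∑ i, (#(S.filter fun n : ℕ => m i n ≠ 0 ∧ ∀ q ∈ (m i n).primeFactors, q ≤ P) : ℝ) := by
    have h := (card_union_le _ _).trans (add_le_add (card_biUnion_le (s := (univ : Finset ι))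
      (t := fun i => S.filter fun n : ℕ => ∃ p a : ℕ, p.Prime ∧ 2 ≤ a ∧ m i n = p ^ a))
      (card_biUnion_le (s := (univ : Finset ι))
      (t := fun i => S.filter fun n : ℕ => m i n ≠ 0 ∧ ∀ q ∈ (m i n).primeFactors, q ≤ P)))
    rw [hBad]
    exact_mod_cast h
  have hsumPP : (∑ i, (#(S.filter fun n : ℕ => ∃ p a : ℕ, p.Prime ∧ 2 ≤ a ∧ m i n = p ^ a) : ℝ))
      * Real.log x ^ k ≤ k * (δ' * x) := by
    rw [sum_mul]
    refine (sum_le_sum fun i _ => hPPx i).trans ?_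
    rw [sum_const, card_univ, nsmul_eq_mul]
  have hsumSM : (∑ i, (#(S.filter fun n : ℕ => m i n ≠ 0 ∧ ∀ q ∈ (m i n).primeFactors, q ≤ P) : ℝ))
      * Real.log x ^ k ≤ k * (δ' * x) := by
    rw [sum_mul]
    refine (sum_le_sum fun i _ => hSMx i).trans ?_
    rw [sum_const, card_univ, nsmul_eq_mul]
  have hx0 : (0 : ℝ) ≤ x := Nat.cast_nonneg x
  have hfin : c * (k * (δ' * x) + k * (δ' * x)) ≤ δ / 2 * x := by
    have e : c * (k * (δ' * x) + k * (δ' * x)) = c / (c + 1) * (δ / 2 * x) := by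
      rw [hδ']
      field_simp
      ring
    rw [e]
    have h1 : c / (c + 1) ≤ 1 := by
      rw [div_le_one (by positivity)]
      linarith
    have h2 : 0 ≤ δ / 2 * x := by positivity
    nlinarith
  calc |∑ n ∈ S, g n|
      = |∑ n ∈ S.filter (fun n : ℕ => n < N), g n + ∑ n ∈ T, g n| := by
        rw [sum_filter_add_sum_filter_not]
    _ ≤ ∑ n ∈ S.filter (fun n : ℕ => n < N), |g n| + ∑ n ∈ T, |g n| :=
        (abs_add_le _ _).trans (add_le_add (abs_sum_le_sum_abs _ _) (abs_sum_le_sum_abs _ _))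
    _ ≤ C₁ + #Bad * (c * Real.log x ^ k) := add_le_add hlow hhigh
    _ ≤ δ / 2 * x + ((∑ i, (#(S.filter fun n : ℕ => ∃ p a : ℕ, p.Prime ∧ 2 ≤ a ∧ m i n = p ^ a) : ℝ))
          + ∑ i, (#(S.filter fun n : ℕ => m i n ≠ 0 ∧ ∀ q ∈ (m i n).primeFactors, q ≤ P) : ℝ))
          * (c * Real.log x ^ k) := add_le_add hC₁x' (mul_le_mul_of_nonneg_right hBadle hckx)
    _ = δ / 2 * x + c * ((∑ i, (#(S.filter fun n : ℕ =>
            ∃ p a : ℕ, p.Prime ∧ 2 ≤ a ∧ m i n = p ^ a) : ℝ)) * Real.log x ^ k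
          + (∑ i, (#(S.filter fun n : ℕ => m i n ≠ 0 ∧ ∀ q ∈ (m i n).primeFactors, q ≤ P) : ℝ))
            * Real.log x ^ k) := by ring
    _ ≤ δ / 2 * x + c * (k * (δ' * x) + k * (δ' * x)) := by gcongr
    _ ≤ δ / 2 * x + δ / 2 * x := add_le_add le_rfl hfin
    _ = δ * x := by ring

open scoped Classical in
/-- **The Bateman–Horn conjecture for a system `f` is the statement `ψ_{k,f}(x) ~ k!·C(f)·x`:**
`BatemanHornAsymptotic f ↔ ∑_{1 ≤ n ≤ x} Λ_k(|∏ᵢ fᵢ(n)|) ~ k! · batemanHornConst f · x`, `k = card ι ≥ 1`, for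
every Bateman–Horn system `f : ι → ℤ[X]`. -/
theorem batemanHornAsymptotic_iff_isEquivalent_psiK [Nonempty ι] {f : ι → ℤ[X]}
    (hf : IsBatemanHornSystem f) :
    BatemanHornAsymptotic f ↔
      (fun x : ℕ => ∑ n ∈ Icc 1 x,
          generalizedVonMangoldt (Fintype.card ι) ((∏ i, f i).eval (n : ℤ)).natAbs) ~[atTop]
        fun x : ℕ => ((Fintype.card ι).factorial : ℝ) * batemanHornConst f * (x : ℝ) := by
  have hk : 0 < Fintype.card ι := Fintype.card_pos
  obtain ⟨-, hCpos⟩ := IsBatemanHornSystem.hasBatemanHornConst_holds hf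
  have hfac : (0 : ℝ) < (Fintype.card ι).factorial := by exact_mod_cast Nat.factorial_pos _
  have hE := isLittleO_psiK_sub_theta hf hk
  have hbig : (fun x : ℕ => (x : ℝ)) =O[atTop]
      fun x : ℕ => ((Fintype.card ι).factorial : ℝ) * (batemanHornConst f * (x : ℝ)) :=
    (isBigO_self_const_mul hCpos.ne' (fun x : ℕ => (x : ℝ)) atTop).trans
      (isBigO_self_const_mul hfac.ne' _ atTop)
  have hE' := hE.trans_isBigO hbig
  have e : (fun x : ℕ => ((Fintype.card ι).factorial : ℝ) * batemanHornConst f * (x : ℝ))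
      = fun x : ℕ => ((Fintype.card ι).factorial : ℝ) * (batemanHornConst f * (x : ℝ)) :=
    funext fun x => mul_assoc _ _ _
  rw [batemanHornAsymptotic_iff_isEquivalent_theta_system hf, e,
    isEquivalent_congr_of_isLittleO_sub hE']
  constructor
  · intro hΘ
    exact isEquivalent_const_mul_left hΘ _
  · intro hkΘ
    have h := isEquivalent_const_mul_left hkΘ (((Fintype.card ι).factorial : ℝ)⁻¹)
    simp only [inv_mul_cancel_left₀ hfac.ne'] at h
    exact h

/-- The `Fin k` form: for `f : Fin k → ℤ[X]` a Bateman–Horn system with `k ≠ 0`,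
`BatemanHornAsymptotic f ↔ ∑_{1 ≤ n ≤ x} Λ_k(|∏ᵢ fᵢ(n)|) ~ k! · batemanHornConst f · x`. -/
theorem batemanHornAsymptotic_iff_isEquivalent_psiK_fin {k : ℕ} (hk : k ≠ 0) {f : Fin k → ℤ[X]}
    (hf : IsBatemanHornSystem f) :
    BatemanHornAsymptotic f ↔
      (fun x : ℕ => ∑ n ∈ Icc 1 x, generalizedVonMangoldt k ((∏ i, f i).eval (n : ℤ)).natAbs) ~[atTop]
        fun x : ℕ => (k.factorial : ℝ) * batemanHornConst f * (x : ℝ) := by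
  haveI : Nonempty (Fin k) := ⟨⟨0, Nat.pos_of_ne_zero hk⟩⟩
  have h := batemanHornAsymptotic_iff_isEquivalent_psiK hf
  rw [Fintype.card_fin] at h
  exact h

end Summit.Parity.BatemanHorn.Theorems
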